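import Literature.NumberTheory.Sieve.GreenTao2008SharpGYDiagonal
import Literature.NumberTheory.Sieve.SmoothMajorantMain
import HarnessLib

/-!
# The sharp Goldston–Yıldırım sums, III: local factors, the product model, and the expansion over coupled primes

Trunk T-SIEVE. Third file of the proof of Green–Tao 2008, Proposition 9.8
(`Literature.NumberTheory.Sieve.GreenTao2008.MeasureLinearForms`; B. Green, T. Tao, Ann. of Math. 167
(2008), §10). After the Chinese remainder theorem (the tree's `CFZ.tupleDensity_eq_prod_localDensity`,
(10.2)–(10.3) of the source) the main term of Proposition 9.5 for the sharply truncated divisor sum is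

  `S(P) = ∑_{dd} (∏_v μ(dd_v)) · E_{ℤ_D^t}[dd ∣ θ] · ∏_v λ_R(dd_v)`,  `λ_R(d) = log₊(R/d)`  (`sharpTupleSum`),

a sum over square-free `2m`-tuples `dd` (indexed by `[m] ⊔ [m]`, prime factors in a finite set `P`),
whose weight is the product over primes of the local factors `T_p(Y) = (-1)^{|Y|} ω_p(π Y)` of the
divisibility pattern `Y = Y_p(dd) ⊆ [m] ⊔ [m]` (`locT`; `ω_p` = `CFZ.localDensity₀`; Lemma 10.1 of
the source = `CFZ.localDensity_singleton` / `localDensity_le_of_minor`).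

Part A compares `T_p` with the model `T^mod_p(Y) = ∏_j σ_p([inl j ∈ Y], [inr j ∈ Y])` of
independent forms (`locM`; `σ_p(α,β) = (-1/p)^α (-1/p)^β p^{αβ}` off `W`, `[Y = ∅]` at `p ∣ W`):
they agree unless `p ∤ W` and `|π Y| ≥ 2`, where both are `O(p⁻²)` (`abs_locD_le`,
`sum_abs_locD_le`: `∑_Y |T_p - T^mod_p| ≤ 2·4^m/p²` — the coefficient form of `E_p = E'_p(1 + O(p⁻²))`,
(10.8)/Lemma 10.3), and proves `(∏_v μ(dd_v)) E[dd ∣ θ] = ∏_{p ∈ P} T_p(Y_p(dd))`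
(`prod_moebius_mul_tupleDensity_eq`) and the factorisation of the model into one-form weights
`∏_p T^mod_p(Y_p(dd)) = ∏_j τ_W(dd_{inl j}, dd_{inr j})`, `τ_W(a,b) = 𝟙[(ab,W)=1] μ(a)μ(b) gcd(a,b)/(ab)`
(`prod_locM_eq_prod_tauW`).

Part B expands `∏_p (T^mod_p + Δ_p) = ∑_{S ⊆ P} ∏_{p∈S} Δ_p ∏_{p∉S} T^mod_p` (`sharpTupleSum_eq_sum_sTerm`).
Splitting each tuple into its `S`-part `u` and its `S`-free part (`sum_tuples_split`), the `S`-term is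
`∑_u Δ_S(u) ∏_j S₁(sW; R/u_{inl j}, R/u_{inr j})` (`sTerm_eq_sum_prod_diagSum`; `s = ∏ S`, `S₁` =
`diagSum` of file II); the term `S = ∅` is `S₁(W; R, R)^m` (`sTerm_empty`), and for `S ≠ ∅`
(necessarily primes `> w`, where `|Δ_p| ≤ 2/p²`) the crude bound `|S₁(sW;·,·)| ≤ B²(sW/φ(sW))² G_W(R)`
gives

  `|S(P) - S₁(W;R,R)^m| ≤ (exp(2·16^m/w) - 1) (B² (W/φ(W))² G_W(R))^m`   (`abs_sharpTupleSum_sub_pow_le`),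

the coefficient-level form of `G₁(0,0) = 1 + o_m(1)` in Lemma 10.3 of the source (the analytic
continuation and the contour shifts of Lemma 10.4 are thereby avoided: all the depth is in
`M(y) → 1` of file I).

## References

* B. Green, T. Tao, Ann. of Math. (2) 167 (2008), 481–547: §10, (10.2)–(10.9), Lemma 10.1,
  Lemma 10.3. [cite: GreenTaoAnnals2008]
* D. Conlon, J. Fox, Y. Zhao, *The Green–Tao theorem: an exposition*, EMS Surv. Math. Sci. 1 (2014),
  §9 (the local factors, as formalised in the tree's `CFZ` files). [cite: ConlonFoxZhao2014]
-/

noncomputable section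

open Finset Real
open scoped ArithmeticFunction.Moebius

namespace Literature.NumberTheory.Sieve.GreenTao2008.SharpGY

open Literature.NumberTheory.Sieve.CFZ

variable {m t : ℕ}

/-! ### The sharp weight `λ_R(d) = log₊(R/d)` -/

/-- `λ_R(d) = log₊(R/d) = max(0, log(R/d))` (`= log(R/d)` for `1 ≤ d ≤ R`, `= 0` for `d ≥ R`):
the weight of Green–Tao's Definition 9.2, `Λ_R(n) = ∑_{d ∣ n} μ(d) λ_R(d)`.
[cite: GreenTaoAnnals2008, Definition 9.2] -/
def lamR (R : ℝ) (d : ℕ) : ℝ := max 0 (Real.log (R / d))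

/-- `λ_R ≥ 0`. [cite: GreenTaoAnnals2008, Definition 9.2] -/
theorem lamR_nonneg (R : ℝ) (d : ℕ) : 0 ≤ lamR R d := le_max_left _ _

/-- `λ_R(d) = log(R/d)` for `1 ≤ d ≤ R`. [cite: GreenTaoAnnals2008, Definition 9.2] -/
theorem lamR_eq_log {R : ℝ} {d : ℕ} (hd : 1 ≤ d) (hdR : (d : ℝ) ≤ R) : lamR R d = Real.log (R / d) := by
  unfold lamR
  have hd0 : (0 : ℝ) < d := by exact_mod_cast hd
  exact max_eq_right (Real.log_nonneg ((one_le_div hd0).2 hdR))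

/-- `λ_R(d) = 0` for `d ≥ R ≥ 0` (`d ≥ 1`). [cite: GreenTaoAnnals2008, Definition 9.2] -/
theorem lamR_eq_zero {R : ℝ} (hR : 0 ≤ R) {d : ℕ} (hd : 1 ≤ d) (hdR : R ≤ d) : lamR R d = 0 := by
  unfold lamR
  have hd0 : (0 : ℝ) < d := by exact_mod_cast hd
  exact max_eq_left (Real.log_nonpos (div_nonneg hR hd0.le) ((div_le_one hd0).2 hdR))

/-- `λ_R(d) ≤ log R` for `d ≥ 1`, `R ≥ 1`. [cite: GreenTaoAnnals2008, Definition 9.2] -/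
theorem lamR_le_log {R : ℝ} (hR : 1 ≤ R) {d : ℕ} (hd : 1 ≤ d) : lamR R d ≤ Real.log R := by
  unfold lamR
  have hd0 : (0 : ℝ) < d := by exact_mod_cast hd
  refine max_le (Real.log_nonneg hR) ?_
  rw [Real.log_div (by linarith) hd0.ne']
  linarith [Real.log_nonneg (show (1 : ℝ) ≤ d by exact_mod_cast hd)]

/-- `λ_R(u d) = λ_{R/u}(d)` (`u ≥ 1`). [cite: GreenTaoAnnals2008, Definition 9.2] -/
theorem lamR_mul {R : ℝ} {u : ℕ} (hu : 1 ≤ u) (d : ℕ) : lamR R (u * d) = lamR (R / u) d := by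
  unfold lamR
  have hu0 : (0 : ℝ) < u := by exact_mod_cast hu
  push_cast
  rw [div_div]

/-! ### Local factors: the true factor `T_p`, the model `T^mod_p`, and their difference -/

/-- **The true local factor** `T_p(Y) = (-1)^{|Y|} ω_p(π Y)` of a pattern `Y ⊆ [m] ⊔ [m]`
(`(-1)^{|Y|} = ∏_{v ∈ Y} μ(p)`; `ω_p(X) = E_{ℤ_p^t}[θ_i ≡ 0 ∀ i ∈ X]`, (10.3)).
[cite: GreenTaoAnnals2008, Section 10 eq. 10.7] -/
def locT (p W : ℕ) (L : Fin m → Fin t → ℤ) (b : Fin m → ℤ) (Y : Finset (Fin m ⊕ Fin m)) : ℝ :=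
  (-1) ^ Y.card * localDensity₀ p W L b (projPattern Y)

/-- The one-slot model weight `σ_p(α, β) = (-1/p)^α (-1/p)^β p^{αβ}` (`α, β` the divisibility bits of
`d_j`, `d'_j` at `p`): `μ(d_j) μ(d'_j)/lcm` localised at `p` for independent forms.
[cite: GreenTaoAnnals2008, Section 10 eq. 10.8] -/
def sigmaP (p : ℕ) (α β : Prop) [Decidable α] [Decidable β] : ℝ :=
  (if α then -((p : ℝ)⁻¹) else 1) * (if β then -((p : ℝ)⁻¹) else 1) * (if α ∧ β then (p : ℝ) else 1)

/-- **The model local factor** `T^mod_p(Y)`: `[Y = ∅]` for `p ∣ W` (the `W`-trick), and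
`∏_j σ_p([inl j ∈ Y], [inr j ∈ Y])` for `p ∤ W` (distinct forms independent modulo `p`).
[cite: GreenTaoAnnals2008, Section 10 eq. 10.8] -/
def locM (p W : ℕ) (Y : Finset (Fin m ⊕ Fin m)) : ℝ :=
  if p ∣ W then (if Y = ∅ then 1 else 0) else ∏ j : Fin m, sigmaP p (Sum.inl j ∈ Y) (Sum.inr j ∈ Y)

/-- The difference `Δ_p = T_p - T^mod_p` (supported on `p ∤ W`, `|π Y| ≥ 2`).
[cite: GreenTaoAnnals2008, Section 10 eq. 10.8] -/
def locD (p W : ℕ) (L : Fin m → Fin t → ℤ) (b : Fin m → ℤ) (Y : Finset (Fin m ⊕ Fin m)) : ℝ :=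
  locT p W L b Y - locM p W Y

/-- `T_p = T^mod_p + Δ_p`. [folklore] -/
theorem locT_eq_add (p W : ℕ) (L : Fin m → Fin t → ℤ) (b : Fin m → ℤ) (Y : Finset (Fin m ⊕ Fin m)) :
    locT p W L b Y = locD p W L b Y + locM p W Y := by
  unfold locD; ring

/-- `|σ_p(α, β)| = p^{-[α ∨ β]}` (`p ≥ 1`). [folklore] -/
theorem abs_sigmaP {p : ℕ} (hp : 1 ≤ p) (α β : Prop) [Decidable α] [Decidable β] :
    |sigmaP p α β| = if α ∨ β then (p : ℝ)⁻¹ else 1 := by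
  have hp0 : (0 : ℝ) < p := by exact_mod_cast hp
  unfold sigmaP
  by_cases ha : α <;> by_cases hb : β <;> simp [ha, hb, abs_mul, abs_inv, abs_of_pos hp0]
  field_simp

/-- `σ_p(false, false) = 1`. [folklore] -/
theorem sigmaP_false_false (p : ℕ) : sigmaP p False False = 1 := by simp [sigmaP]

/-! #### At primes dividing `W`: `T_p = T^mod_p = [Y = ∅]` -/

/-- For `p ∣ W` prime: `T_p(Y) = [Y = ∅]` (`ω_p(∅) = 1`, `ω_p(X) = 0` for `X ≠ ∅`, the `W`-trick).
[cite: GreenTaoAnnals2008, Lemma 10.1] -/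
theorem locT_of_dvd {p W : ℕ} [Fact p.Prime] (hpW : p ∣ W) (L : Fin m → Fin t → ℤ) (b : Fin m → ℤ)
    (Y : Finset (Fin m ⊕ Fin m)) : locT p W L b Y = if Y = ∅ then 1 else 0 := by
  haveI : NeZero p := ⟨(Fact.out : p.Prime).ne_zero⟩
  unfold locT
  split_ifs with hY
  · subst hY; simp
  · rw [localDensity₀_eq, localDensity_eq_zero_of_dvd hpW L b (projPattern_nonempty (nonempty_iff_ne_empty.2 hY))]
    simp

/-- For `p ∣ W`: `Δ_p = 0`. [cite: GreenTaoAnnals2008, Lemma 10.1] -/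
theorem locD_of_dvd {p W : ℕ} [Fact p.Prime] (hpW : p ∣ W) (L : Fin m → Fin t → ℤ) (b : Fin m → ℤ)
    (Y : Finset (Fin m ⊕ Fin m)) : locD p W L b Y = 0 := by
  unfold locD locM
  rw [locT_of_dvd hpW, if_pos hpW, sub_self]

/-! #### At primes not dividing `W`: agreement on `|π Y| ≤ 1`, size `p⁻²` beyond -/

section OffW

variable {p W n : ℕ} [Fact p.Prime] (hpW : ¬ p ∣ W) (L : Fin m → Fin (n + 1) → ℤ) (b : Fin m → ℤ)
  (hrow : ∀ i, ∃ j, (L i j : ZMod p) ≠ 0)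
  (hmin : ∀ i i', i ≠ i' → ∃ j₀ j₁ : Fin (n + 1), j₀ ≠ j₁ ∧
    ((L i j₀ * L i' j₁ - L i j₁ * L i' j₀ : ℤ) : ZMod p) ≠ 0)
include hpW

omit hpW in
/-- `|T^mod_p(Y)| = p^{-|π Y|}` for `p ∤ W`. [cite: GreenTaoAnnals2008, Section 10 eq. 10.8] -/
theorem abs_locM_eq (hpW : ¬ p ∣ W) (Y : Finset (Fin m ⊕ Fin m)) :
    |locM p W Y| = ((p : ℝ)⁻¹) ^ (projPattern Y).card := by
  have hp1 : 1 ≤ p := (Fact.out : p.Prime).one_lt.le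
  unfold locM
  rw [if_neg hpW, abs_prod]
  rw [Finset.prod_congr rfl fun j _ => abs_sigmaP hp1 (Sum.inl j ∈ Y) (Sum.inr j ∈ Y)]
  rw [prod_ite, prod_const_one, mul_one, prod_const]
  congr 1

include hrow in
/-- **`T_p = T^mod_p` when `|π Y| ≤ 1`** (`p ∤ W`, rows nonzero mod `p`): `Y = ∅` gives `1 = 1`;
`π Y = {j}` means `Y ∈ {{inl j}, {inr j}, {inl j, inr j}}` with `T_p = -1/p, -1/p, +1/p`
(`ω_p({j}) = 1/p`, Lemma 10.1) `= σ_p(1,0), σ_p(0,1), σ_p(1,1)`. [cite: GreenTaoAnnals2008, Lemma 10.1] -/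
theorem locD_eq_zero_of_card_le_one {Y : Finset (Fin m ⊕ Fin m)} (hY : (projPattern Y).card ≤ 1) :
    locD p W L b Y = 0 := by
  classical
  haveI : NeZero p := ⟨(Fact.out : p.Prime).ne_zero⟩
  have hp0 : (p : ℝ) ≠ 0 := by exact_mod_cast (Fact.out : p.Prime).ne_zero
  unfold locD locM locT
  rw [if_neg hpW, sub_eq_zero]
  rcases Nat.lt_or_ge (projPattern Y).card 1 with h0 | h1
  · -- `π Y = ∅`, so `Y = ∅`
    have hπ : projPattern Y = ∅ := card_eq_zero.1 (by omega)
    have hY0 : Y = ∅ := projPattern_eq_empty_iff.1 hπ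
    subst hY0
    simp [sigmaP]
  · -- `π Y = {j}`
    have hc : (projPattern Y).card = 1 := le_antisymm hY h1
    obtain ⟨j, hj⟩ := card_eq_one.1 hc
    have hmem : Y ∈ (univ : Finset (Finset (Fin m ⊕ Fin m))).filter (fun Y => projPattern Y = {j}) :=
      mem_filter.2 ⟨mem_univ _, hj⟩
    rw [filter_projPattern_eq_singleton j] at hmem
    have hω : localDensity₀ p W L b {j} = 1 / p := by
      obtain ⟨j₀, hj₀⟩ := hrow j
      rw [localDensity₀_eq]; exact localDensity_singleton hpW L b j hj₀
    -- the product over slots: only `j` contributes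
    have hprod : ∀ (Y' : Finset (Fin m ⊕ Fin m)), projPattern Y' = {j} →
        ∏ j' : Fin m, sigmaP p (Sum.inl j' ∈ Y') (Sum.inr j' ∈ Y') = sigmaP p (Sum.inl j ∈ Y') (Sum.inr j ∈ Y') := by
      intro Y' hY'
      rw [← Finset.prod_erase_mul _ _ (mem_univ j)]
      rw [Finset.prod_eq_one]
      · rw [one_mul]
      · intro j' hj'
        have hne : j' ≠ j := ne_of_mem_erase hj'
        have hnot : ¬ (Sum.inl j' ∈ Y' ∨ Sum.inr j' ∈ Y') := by
          intro h
          have : j' ∈ projPattern Y' := by simp [projPattern, h]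
          rw [hY', mem_singleton] at this
          exact hne this
        push Not at hnot
        simp [sigmaP, hnot.1, hnot.2]
    simp only [mem_insert, mem_singleton] at hmem
    rcases hmem with rfl | rfl | rfl
    · rw [hprod _ (by ext; simp [projPattern]), show projPattern ({Sum.inl j} : Finset (Fin m ⊕ Fin m)) = {j} by
        ext; simp [projPattern], hω]
      simp [sigmaP]
    · rw [hprod _ (by ext; simp [projPattern]), show projPattern ({Sum.inr j} : Finset (Fin m ⊕ Fin m)) = {j} by
        ext; simp [projPattern], hω]
      simp [sigmaP]
    · rw [hprod _ (by ext; simp [projPattern]),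
        show projPattern ({Sum.inl j, Sum.inr j} : Finset (Fin m ⊕ Fin m)) = {j} by
          ext; simp [projPattern], hω]
      rw [card_pair (by simp)]
      simp [sigmaP]
      field_simp

include hmin in
/-- `|T_p(Y)| ≤ 1/p²` when `|π Y| ≥ 2` (`p ∤ W`, independent rows mod `p`: Lemma 10.1, "`ω_X(p) ≤ p⁻²`
when `|X| ≥ 2`"). [cite: GreenTaoAnnals2008, Lemma 10.1] -/
theorem abs_locT_le_of_two_le {Y : Finset (Fin m ⊕ Fin m)} (hY : 2 ≤ (projPattern Y).card) :
    |locT p W L b Y| ≤ 1 / (p : ℝ) ^ 2 := by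
  haveI : NeZero p := ⟨(Fact.out : p.Prime).ne_zero⟩
  obtain ⟨i, i', hi, hi', hii'⟩ := Finset.one_lt_card_iff.1 (show 1 < (projPattern Y).card by omega)
  obtain ⟨j₀, j₁, hj, hM⟩ := hmin i i' hii'
  unfold locT
  rw [abs_mul, abs_pow, abs_neg, abs_one, one_pow, one_mul, localDensity₀_eq,
    abs_of_nonneg (localDensity_nonneg_le_one L b _).1]
  exact localDensity_le_of_minor hpW L b hi hi' hj hM

omit hpW in
/-- `|T^mod_p(Y)| ≤ 1/p²` when `|π Y| ≥ 2`. [cite: GreenTaoAnnals2008, Section 10 eq. 10.8] -/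
theorem abs_locM_le_of_two_le (hpW : ¬ p ∣ W) {Y : Finset (Fin m ⊕ Fin m)} (hY : 2 ≤ (projPattern Y).card) :
    |locM p W Y| ≤ 1 / (p : ℝ) ^ 2 := by
  rw [abs_locM_eq hpW, one_div, ← inv_pow]
  have hp1 : (1 : ℝ) ≤ p := by exact_mod_cast (Fact.out : p.Prime).one_lt.le
  have hle : (p : ℝ)⁻¹ ≤ 1 := inv_le_one_of_one_le₀ hp1
  exact pow_le_pow_of_le_one (by positivity) hle hY

include hrow hmin in
/-- **`|Δ_p(Y)| ≤ 2/p²` for all `Y`** (`p ∤ W`, non-degenerate system mod `p`).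
[cite: GreenTaoAnnals2008, Section 10 eq. 10.8] -/
theorem abs_locD_le (Y : Finset (Fin m ⊕ Fin m)) : |locD p W L b Y| ≤ 2 / (p : ℝ) ^ 2 := by
  rcases Nat.lt_or_ge (projPattern Y).card 2 with h | h
  · rw [locD_eq_zero_of_card_le_one hpW L b hrow (by omega), abs_zero]; positivity
  · unfold locD
    calc |locT p W L b Y - locM p W Y| ≤ |locT p W L b Y| + |locM p W Y| := abs_sub _ _
      _ ≤ 1 / (p : ℝ) ^ 2 + 1 / (p : ℝ) ^ 2 :=
          add_le_add (abs_locT_le_of_two_le hpW L b hmin h) (abs_locM_le_of_two_le hpW h)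
      _ = 2 / (p : ℝ) ^ 2 := by ring

include hrow hmin in
/-- **`∑_Y |Δ_p(Y)| ≤ 2 · 4^m / p²`** (`4^m` patterns). [cite: GreenTaoAnnals2008, Lemma 10.3] -/
theorem sum_abs_locD_le : ∑ Y : Finset (Fin m ⊕ Fin m), |locD p W L b Y| ≤ 2 * 4 ^ m / (p : ℝ) ^ 2 := by
  calc ∑ Y : Finset (Fin m ⊕ Fin m), |locD p W L b Y| ≤ ∑ _Y : Finset (Fin m ⊕ Fin m), 2 / (p : ℝ) ^ 2 :=
        sum_le_sum fun Y _ => abs_locD_le hpW L b hrow hmin Y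
    _ = 2 * 4 ^ m / (p : ℝ) ^ 2 := by
        rw [sum_const, card_univ, Fintype.card_finset, Fintype.card_sum, Fintype.card_fin, nsmul_eq_mul]
        push_cast
        rw [← two_mul, pow_mul]
        norm_num
        ring

end OffW

/-! ### The true weight is the product of the true local factors -/

/-- `v ∈ Y_p(dd) ↔ p ∣ dd_v`. [folklore] -/
theorem mem_pattern_iff {ι : Type*} [Fintype ι] (d : ι → ℕ) (p : ℕ) (v : ι) : v ∈ pattern d p ↔ p ∣ d v := by
  simp [pattern]

/-- For a square-free tuple with prime factors in `P`: `∏_v μ(dd_v) = ∏_{p ∈ P} (-1)^{|Y_p(dd)|}`.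
[cite: GreenTaoAnnals2008, Section 10 eq. 10.6] -/
theorem prod_moebius_eq_prod_pattern {ι : Type*} [Fintype ι] [DecidableEq ι] {P : Finset ℕ}
    (hP : ∀ p ∈ P, p.Prime) {dd : ι → ℕ} (hdd : ∀ v, dd v ∈ squarefreeOf P) :
    ∏ v, (μ (dd v) : ℝ) = ∏ p ∈ P, (-1 : ℝ) ^ (pattern dd p).card := by
  have hsq : ∀ v, Squarefree (dd v) ∧ (dd v).primeFactors ⊆ P := fun v => (mem_squarefreeOf hP).1 (hdd v)
  have hμ : ∀ v, (μ (dd v) : ℝ) = ∏ _p ∈ (dd v).primeFactors, (-1 : ℝ) := by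
    intro v
    rw [prod_const, ArithmeticFunction.moebius_apply_of_squarefree (hsq v).1,
      ← card_primeFactors_eq_cardFactors (hsq v).1]
    push_cast; rfl
  rw [Fintype.prod_congr _ _ hμ]
  rw [Finset.prod_comm' (s := univ) (t := fun v => (dd v).primeFactors) (t' := P) (s' := fun p => pattern dd p)]
  · exact prod_congr rfl fun p _ => prod_const _
  · intro v p
    simp only [mem_univ, true_and, mem_pattern_iff]
    constructor
    · intro hp; exact ⟨Nat.dvd_of_mem_primeFactors hp, (hsq v).2 hp⟩
    · rintro ⟨hpd, hpP⟩; exact Nat.mem_primeFactors.2 ⟨hP p hpP, hpd, (hsq v).1.ne_zero⟩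

/-- **`(∏_v μ(dd_v)) · E_{ℤ_D^t}[dd ∣ θ] = ∏_{p ∈ P} T_p(Y_p(dd))`** for square-free tuples with
prime factors in `P` (CRT factorisation of the density, (10.2)–(10.3), and of the Möbius signs).
[cite: GreenTaoAnnals2008, Section 10 eq. 10.3] -/
theorem prod_moebius_mul_tupleDensity_eq {P : Finset ℕ} (hP : ∀ p ∈ P, p.Prime) (W : ℕ)
    (L : Fin m → Fin t → ℤ) (b : Fin m → ℤ) {dd : Fin m ⊕ Fin m → ℕ} (hdd : ∀ v, dd v ∈ squarefreeOf P) :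
    (∏ v, (μ (dd v) : ℝ)) * tupleDensity W L b (fun j => dd (Sum.inl j)) (fun j => dd (Sum.inr j)) =
      ∏ p ∈ P, locT p W L b (pattern dd p) := by
  classical
  unfold locT
  rw [prod_mul_distrib, prod_moebius_eq_prod_pattern hP hdd,
    tupleDensity_eq_prod_localDensity W L b hP (fun j => hdd _) (fun j => hdd _)]
  congr 1
  exact prod_congr rfl fun p _ => by rw [projPattern_pattern]

/-! ### The model weight factorises into one-form weights -/

/-- **The one-form weight** `τ_W(a, b) = 𝟙[(a,W)=(b,W)=1] μ(a) μ(b) gcd(a,b)/(ab)`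
(`= μ(a)μ(b)/lcm(a,b)` restricted to numbers coprime to `W`), the summand of `diagSum`.
[cite: GreenTaoAnnals2008, Section 10 eq. 10.2] -/
def tauW (W a b : ℕ) : ℝ :=
  if a.Coprime W ∧ b.Coprime W then (μ a : ℝ) / a * ((μ b : ℝ) / b) * (Nat.gcd a b : ℝ) else 0

/-- For square-free `a` coprime to `W` with prime factors in `P'`: the primes of `P'` off `W`
dividing `a` are exactly the prime factors of `a`. [folklore] -/
theorem filter_dvd_eq_primeFactors {P' : Finset ℕ} (hP' : ∀ p ∈ P', p.Prime) {W a : ℕ}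
    (ha : a ∈ squarefreeOf P') (haW : a.Coprime W) :
    (P'.filter (fun p => ¬ p ∣ W)).filter (fun p => p ∣ a) = a.primeFactors := by
  obtain ⟨hsq, hsub⟩ := (mem_squarefreeOf hP').1 ha
  ext p
  simp only [mem_filter, Nat.mem_primeFactors, ne_eq]
  constructor
  · rintro ⟨⟨hp, _⟩, hpa⟩; exact ⟨hP' p hp, hpa, hsq.ne_zero⟩
  · rintro ⟨hp, hpa, _⟩
    have hpm : p ∈ a.primeFactors := Nat.mem_primeFactors.2 ⟨hp, hpa, hsq.ne_zero⟩
    refine ⟨⟨hsub hpm, fun hpW' => ?_⟩, hpa⟩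
    exact hp.ne_one (Nat.Coprime.eq_one_of_dvd (haW.coprime_dvd_left hpa) hpW')

/-- `∏_{p ∣ a} (-1/p) = μ(a)/a` for square-free `a`. [folklore] -/
theorem prod_primeFactors_neg_inv {a : ℕ} (ha : Squarefree a) :
    ∏ p ∈ a.primeFactors, (-((p : ℝ)⁻¹)) = (μ a : ℝ) / a := by
  rw [prod_neg, prod_inv_distrib, ← Nat.cast_prod, Nat.prod_primeFactors_of_squarefree ha,
    ArithmeticFunction.moebius_apply_of_squarefree ha, ← card_primeFactors_eq_cardFactors ha]
  push_cast
  ring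

/-- **The model factorises**: for a tuple `dd` of square-free `P'`-numbers, `P'` a set of primes
containing every prime factor of `W`,
`∏_{p ∈ P'} T^mod_p(Y_p(dd)) = ∏_j τ_W(dd_{inl j}, dd_{inr j})`.
(At `p ∣ W` the model is `[Y_p = ∅]`, i.e. coprimality with `W`; at `p ∤ W` it is
`∏_j σ_p`, and `∏_{p ∤ W} σ_p([p∣a],[p∣b]) = μ(a)μ(b) gcd(a,b)/(ab)`.) [cite: GreenTaoAnnals2008, Section 10 eq. 10.8] -/
theorem prod_locM_eq_prod_tauW {P' : Finset ℕ} (hP' : ∀ p ∈ P', p.Prime) {W : ℕ}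
    (hPW : ∀ p, p.Prime → p ∣ W → p ∈ P') {dd : Fin m ⊕ Fin m → ℕ} (hdd : ∀ v, dd v ∈ squarefreeOf P') :
    ∏ p ∈ P', locM p W (pattern dd p) = ∏ j : Fin m, tauW W (dd (Sum.inl j)) (dd (Sum.inr j)) := by
  classical
  have hsq : ∀ v, Squarefree (dd v) ∧ (dd v).primeFactors ⊆ P' := fun v => (mem_squarefreeOf hP').1 (hdd v)
  -- split the primes of `P'` according to `p ∣ W`
  rw [← prod_filter_mul_prod_filter_not P' (fun p => p ∣ W)]
  -- (1) the `W`-part is the indicator of coprimality with `W`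
  have hWpart : ∏ p ∈ P'.filter (fun p => p ∣ W), locM p W (pattern dd p) =
      if ∀ v, (dd v).Coprime W then 1 else 0 := by
    have h1 : ∏ p ∈ P'.filter (fun p => p ∣ W), locM p W (pattern dd p) =
        ∏ p ∈ P'.filter (fun p => p ∣ W), (if pattern dd p = ∅ then (1 : ℝ) else 0) :=
      prod_congr rfl fun p hp => by unfold locM; rw [if_pos (mem_filter.1 hp).2]
    rw [h1, prod_boole]
    congr 1
    apply propext
    constructor
    · intro h v
      by_contra hc
      obtain ⟨p, hp, hpd, hpW⟩ := Nat.Prime.not_coprime_iff_dvd.1 hc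
      have hpmem : p ∈ P'.filter (fun p => p ∣ W) := mem_filter.2 ⟨hPW p hp hpW, hpW⟩
      have := h p hpmem
      rw [Finset.eq_empty_iff_forall_notMem] at this
      exact this v ((mem_pattern_iff dd p v).2 hpd)
    · intro h p hp
      rw [Finset.eq_empty_iff_forall_notMem]
      intro v hv
      rw [mem_pattern_iff] at hv
      have hpW := (mem_filter.1 hp).2
      have hp := hP' p (mem_filter.1 hp).1
      exact hp.ne_one (Nat.Coprime.eq_one_of_dvd ((h v).coprime_dvd_left hv) hpW)
  -- (2) the off-`W` part, slot by slot
  have hOff : ∏ p ∈ P'.filter (fun p => ¬ p ∣ W), locM p W (pattern dd p) =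
      ∏ j : Fin m, ∏ p ∈ P'.filter (fun p => ¬ p ∣ W),
        sigmaP p (p ∣ dd (Sum.inl j)) (p ∣ dd (Sum.inr j)) := by
    calc ∏ p ∈ P'.filter (fun p => ¬ p ∣ W), locM p W (pattern dd p)
        = ∏ p ∈ P'.filter (fun p => ¬ p ∣ W), ∏ j : Fin m, sigmaP p (p ∣ dd (Sum.inl j)) (p ∣ dd (Sum.inr j)) := by
          refine prod_congr rfl fun p hp => ?_
          unfold locM
          rw [if_neg (mem_filter.1 hp).2]
          refine prod_congr rfl fun j _ => ?_
          simp only [mem_pattern_iff]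
      _ = _ := Finset.prod_comm
  -- (3) the one-slot identity for coprime-to-`W` square-free numbers
  have hslot : ∀ a b : ℕ, a ∈ squarefreeOf P' → b ∈ squarefreeOf P' → a.Coprime W → b.Coprime W →
      ∏ p ∈ P'.filter (fun p => ¬ p ∣ W), sigmaP p (p ∣ a) (p ∣ b) =
        (μ a : ℝ) / a * ((μ b : ℝ) / b) * (Nat.gcd a b : ℝ) := by
    intro a b ha hb haW hbW
    have hsa := ((mem_squarefreeOf hP').1 ha).1
    have hsb := ((mem_squarefreeOf hP').1 hb).1
    unfold sigmaP
    rw [prod_mul_distrib, prod_mul_distrib]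
    rw [prod_ite, prod_const_one, mul_one, prod_ite, prod_const_one, mul_one, prod_ite, prod_const_one, mul_one]
    rw [filter_dvd_eq_primeFactors hP' ha haW, filter_dvd_eq_primeFactors hP' hb hbW]
    rw [prod_primeFactors_neg_inv hsa, prod_primeFactors_neg_inv hsb]
    congr 1
    -- `∏_{p ∣ a, p ∣ b} p = gcd(a, b)`
    have hg : (P'.filter (fun p => ¬ p ∣ W)).filter (fun p => p ∣ a ∧ p ∣ b) = (Nat.gcd a b).primeFactors := by
      rw [Nat.primeFactors_gcd hsa.ne_zero hsb.ne_zero, ← filter_dvd_eq_primeFactors hP' ha haW,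
        ← filter_dvd_eq_primeFactors hP' hb hbW]
      ext p; simp only [mem_filter, mem_inter]; tauto
    rw [hg, ← Nat.cast_prod, Nat.prod_primeFactors_of_squarefree (hsa.squarefree_of_dvd (Nat.gcd_dvd_left a b))]
  rw [hWpart, hOff]
  by_cases hall : ∀ v, (dd v).Coprime W
  · rw [if_pos hall, one_mul]
    refine prod_congr rfl fun j _ => ?_
    unfold tauW
    rw [if_pos ⟨hall _, hall _⟩]
    exact hslot _ _ (hdd _) (hdd _) (hall _) (hall _)
  · rw [if_neg hall, zero_mul]
    push Not at hall
    obtain ⟨v, hv⟩ := hall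
    symm
    apply prod_eq_zero (mem_univ (Sum.elim id id v))
    unfold tauW
    rw [if_neg]
    rcases v with j | j
    · simp only [Sum.elim_inl, id]; exact fun h => hv h.1
    · simp only [Sum.elim_inr, id]; exact fun h => hv h.2


/-! ## Part B: the expansion over the coupled primes -/

/-! ### Splitting square-free tuples at a set of primes -/

/-- The `S`-part of `d`: the product of the prime factors of `d` lying in `S`. [folklore] -/
def sPart (S : Finset ℕ) (d : ℕ) : ℕ := ∏ p ∈ d.primeFactors.filter (fun p => p ∈ S), p

/-- The `S`-free part of `d`: the product of the prime factors of `d` outside `S`. [folklore] -/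
def cPart (S : Finset ℕ) (d : ℕ) : ℕ := ∏ p ∈ d.primeFactors.filter (fun p => p ∉ S), p

/-- `d = sPart · cPart` for square-free `d`. [folklore] -/
theorem sPart_mul_cPart (S : Finset ℕ) {d : ℕ} (hd : Squarefree d) : sPart S d * cPart S d = d := by
  unfold sPart cPart
  rw [prod_filter_mul_prod_filter_not, Nat.prod_primeFactors_of_squarefree hd]

/-- The prime factors of `sPart`. [folklore] -/
theorem primeFactors_sPart (S : Finset ℕ) (d : ℕ) :
    (sPart S d).primeFactors = d.primeFactors.filter (fun p => p ∈ S) := by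
  unfold sPart
  exact Nat.primeFactors_prod fun p hp => Nat.prime_of_mem_primeFactors (mem_filter.1 hp).1

/-- The prime factors of `cPart`. [folklore] -/
theorem primeFactors_cPart (S : Finset ℕ) (d : ℕ) :
    (cPart S d).primeFactors = d.primeFactors.filter (fun p => p ∉ S) := by
  unfold cPart
  exact Nat.primeFactors_prod fun p hp => Nat.prime_of_mem_primeFactors (mem_filter.1 hp).1

/-- `sPart S d ∈ squarefreeOf S` for `d ∈ squarefreeOf P`. [folklore] -/
theorem sPart_mem {P S : Finset ℕ} (hP : ∀ p ∈ P, p.Prime) (hS : S ⊆ P) (d : ℕ) :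
    sPart S d ∈ squarefreeOf S := by
  have hSp : ∀ p ∈ S, p.Prime := fun p hp => hP p (hS hp)
  refine (mem_squarefreeOf hSp).2 ⟨?_, ?_⟩
  · exact squarefree_prod_of_primes fun p hp => Nat.prime_of_mem_primeFactors (mem_filter.1 hp).1
  · rw [primeFactors_sPart]; exact fun p hp => (mem_filter.1 hp).2

/-- `cPart S d ∈ squarefreeOf (P \ S)` for `d ∈ squarefreeOf P`. [folklore] -/
theorem cPart_mem {P S : Finset ℕ} (hP : ∀ p ∈ P, p.Prime) {d : ℕ} (hd : d ∈ squarefreeOf P) :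
    cPart S d ∈ squarefreeOf (P \ S) := by
  have hPp : ∀ p ∈ P \ S, p.Prime := fun p hp => hP p (mem_sdiff.1 hp).1
  have hd' := (mem_squarefreeOf hP).1 hd
  refine (mem_squarefreeOf hPp).2 ⟨?_, ?_⟩
  · exact squarefree_prod_of_primes fun p hp => Nat.prime_of_mem_primeFactors (mem_filter.1 hp).1
  · rw [primeFactors_cPart]
    intro p hp
    exact mem_sdiff.2 ⟨hd'.2 (mem_filter.1 hp).1, (mem_filter.1 hp).2⟩

/-- For `u ∈ squarefreeOf S`, `c ∈ squarefreeOf (P \ S)`: `u c` is square-free with prime factors in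
`P`, and its parts are `u`, `c`. [folklore] -/
theorem mul_mem_and_parts {P S : Finset ℕ} (hP : ∀ p ∈ P, p.Prime) (hS : S ⊆ P) {u c : ℕ}
    (hu : u ∈ squarefreeOf S) (hc : c ∈ squarefreeOf (P \ S)) :
    u * c ∈ squarefreeOf P ∧ sPart S (u * c) = u ∧ cPart S (u * c) = c := by
  have hSp : ∀ p ∈ S, p.Prime := fun p hp => hP p (hS hp)
  have hPp : ∀ p ∈ P \ S, p.Prime := fun p hp => hP p (mem_sdiff.1 hp).1
  obtain ⟨hsu, hpu⟩ := (mem_squarefreeOf hSp).1 hu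
  obtain ⟨hsc, hpc⟩ := (mem_squarefreeOf hPp).1 hc
  have hcop : u.Coprime c := by
    rw [← Nat.disjoint_primeFactors hsu.ne_zero hsc.ne_zero]
    exact disjoint_left.2 fun p hpS hpP => (mem_sdiff.1 (hpc hpP)).2 (hpu hpS)
  have hsq : Squarefree (u * c) := Nat.squarefree_mul_iff.2 ⟨hcop, hsu, hsc⟩
  have hpf : (u * c).primeFactors = u.primeFactors ∪ c.primeFactors := hcop.primeFactors_mul
  refine ⟨(mem_squarefreeOf hP).2 ⟨hsq, ?_⟩, ?_, ?_⟩
  · rw [hpf]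
    exact union_subset (fun p hp => hS (hpu hp)) (fun p hp => (mem_sdiff.1 (hpc hp)).1)
  · unfold sPart
    rw [hpf]
    have : (u.primeFactors ∪ c.primeFactors).filter (fun p => p ∈ S) = u.primeFactors := by
      ext p
      simp only [mem_filter, mem_union]
      constructor
      · rintro ⟨h | h, hpS⟩
        · exact h
        · exact absurd hpS (mem_sdiff.1 (hpc h)).2
      · intro h; exact ⟨Or.inl h, hpu h⟩
    rw [this, Nat.prod_primeFactors_of_squarefree hsu]
  · unfold cPart
    rw [hpf]
    have : (u.primeFactors ∪ c.primeFactors).filter (fun p => p ∉ S) = c.primeFactors := by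
      ext p
      simp only [mem_filter, mem_union]
      constructor
      · rintro ⟨h | h, hpS⟩
        · exact absurd (hpu h) hpS
        · exact h
      · intro h; exact ⟨Or.inr h, (mem_sdiff.1 (hpc h)).2⟩
    rw [this, Nat.prod_primeFactors_of_squarefree hsc]

/-- **Splitting the tuple sum**: for `S ⊆ P`,
`∑_{dd ∈ (squarefreeOf P)^ι} F(dd) = ∑_{u ∈ (squarefreeOf S)^ι} ∑_{c ∈ (squarefreeOf (P∖S))^ι} F(u · c)`.
[folklore] -/
theorem sum_tuples_split {ι : Type*} [Fintype ι] [DecidableEq ι] {P S : Finset ℕ} (hP : ∀ p ∈ P, p.Prime)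
    (hS : S ⊆ P) (F : (ι → ℕ) → ℝ) :
    ∑ dd ∈ Fintype.piFinset (fun _ : ι => squarefreeOf P), F dd =
      ∑ u ∈ Fintype.piFinset (fun _ : ι => squarefreeOf S),
        ∑ c ∈ Fintype.piFinset (fun _ : ι => squarefreeOf (P \ S)), F (u * c) := by
  rw [← sum_product']
  symm
  refine sum_nbij' (fun uc => uc.1 * uc.2) (fun dd => (fun v => sPart S (dd v), fun v => cPart S (dd v)))
    ?_ ?_ ?_ ?_ ?_
  · intro uc huc
    obtain ⟨hu, hc⟩ := mem_product.1 huc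
    rw [Fintype.mem_piFinset] at hu hc ⊢
    exact fun v => (mul_mem_and_parts hP hS (hu v) (hc v)).1
  · intro dd hdd
    rw [Fintype.mem_piFinset] at hdd
    refine mem_product.2 ⟨Fintype.mem_piFinset.2 fun v => sPart_mem hP hS (dd v),
      Fintype.mem_piFinset.2 fun v => cPart_mem hP (hdd v)⟩
  · intro uc huc
    obtain ⟨hu, hc⟩ := mem_product.1 huc
    rw [Fintype.mem_piFinset] at hu hc
    refine Prod.ext (funext fun v => ?_) (funext fun v => ?_)
    · exact (mul_mem_and_parts hP hS (hu v) (hc v)).2.1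
    · exact (mul_mem_and_parts hP hS (hu v) (hc v)).2.2
  · intro dd hdd
    rw [Fintype.mem_piFinset] at hdd
    funext v
    exact sPart_mul_cPart S ((mem_squarefreeOf hP).1 (hdd v)).1
  · intro uc _; rfl

/-- Patterns of a split tuple: at `p ∈ S` the pattern of `u · c` is that of `u`, at `p ∈ P ∖ S` that of `c`.
[folklore] -/
theorem pattern_mul_of_mem {ι : Type*} [Fintype ι] {P S : Finset ℕ} (hP : ∀ p ∈ P, p.Prime) (hS : S ⊆ P)
    {u c : ι → ℕ} (hu : ∀ v, u v ∈ squarefreeOf S) (hc : ∀ v, c v ∈ squarefreeOf (P \ S)) {p : ℕ} :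
    (p ∈ S → pattern (u * c) p = pattern u p) ∧ (p ∈ P \ S → pattern (u * c) p = pattern c p) := by
  have hSp : ∀ p ∈ S, p.Prime := fun p hp => hP p (hS hp)
  have hPp : ∀ p ∈ P \ S, p.Prime := fun p hp => hP p (mem_sdiff.1 hp).1
  constructor
  · intro hpS
    have hp : p.Prime := hSp p hpS
    ext v
    simp only [mem_pattern_iff, Pi.mul_apply]
    obtain ⟨hsc, hpc⟩ := (mem_squarefreeOf hPp).1 (hc v)
    have hnot : ¬ p ∣ c v := fun h =>
      (mem_sdiff.1 (hpc (Nat.mem_primeFactors.2 ⟨hp, h, hsc.ne_zero⟩))).2 hpS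
    constructor
    · intro h; exact (hp.dvd_mul.1 h).resolve_right hnot
    · intro h; exact h.mul_right _
  · intro hpP
    have hp : p.Prime := hPp p hpP
    ext v
    simp only [mem_pattern_iff, Pi.mul_apply]
    obtain ⟨hsu, hpu⟩ := (mem_squarefreeOf hSp).1 (hu v)
    have hnot : ¬ p ∣ u v := fun h =>
      (mem_sdiff.1 hpP).2 (hpu (Nat.mem_primeFactors.2 ⟨hp, h, hsu.ne_zero⟩))
    constructor
    · intro h; exact (hp.dvd_mul.1 h).resolve_left hnot
    · intro h; exact h.mul_left _

/-! ### Factorisation over the slots -/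

/-- **A sum over `[m] ⊔ [m]`-tuples of a product of slot functions is the product of the slot sums**:
`∑_{dd ∈ A^{[m]⊔[m]}} ∏_j F_j(dd_{inl j}, dd_{inr j}) = ∏_j ∑_{a ∈ A} ∑_{b ∈ A} F_j(a, b)`. [folklore] -/
theorem sum_piFinset_sum_prod_eq (A : Finset ℕ) (F : Fin m → ℕ → ℕ → ℝ) :
    ∑ dd ∈ Fintype.piFinset (fun _ : Fin m ⊕ Fin m => A), ∏ j, F j (dd (Sum.inl j)) (dd (Sum.inr j)) =
      ∏ j, ∑ a ∈ A, ∑ b ∈ A, F j a b := by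
  classical
  have h1 : ∏ j, ∑ a ∈ A, ∑ b ∈ A, F j a b = ∏ j : Fin m, ∑ ab ∈ A ×ˢ A, F j ab.1 ab.2 :=
    prod_congr rfl fun j _ => (sum_product' A A (F j)).symm
  rw [h1, prod_univ_sum]
  symm
  refine sum_nbij' (fun g => Sum.elim (fun j => (g j).1) (fun j => (g j).2))
    (fun dd j => (dd (Sum.inl j), dd (Sum.inr j))) ?_ ?_ ?_ ?_ ?_
  · intro g hg
    rw [Fintype.mem_piFinset] at hg ⊢
    rintro (j | j)
    · exact (mem_product.1 (hg j)).1
    · exact (mem_product.1 (hg j)).2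
  · intro dd hdd
    rw [Fintype.mem_piFinset] at hdd ⊢
    exact fun j => mem_product.2 ⟨hdd _, hdd _⟩
  · intro g _; funext j; simp
  · intro dd _; funext v; rcases v with j | j <;> simp
  · intro g _; simp

/-! ### The sharp tuple sum and the term indexed by `S` -/

/-- **The sharp tuple sum** `S(P) = ∑_{dd} (∏_v μ(dd_v)) E_{ℤ_D^t}[dd ∣ θ] ∏_v λ_R(dd_v)` over
`[m] ⊔ [m]`-tuples of square-free numbers with prime factors in `P` (the main term (10.2) of Prop. 9.5
for the sharp cutoff, before normalisation). [cite: GreenTaoAnnals2008, Section 10 eq. 10.2] -/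
def sharpTupleSum (P : Finset ℕ) (W : ℕ) (L : Fin m → Fin t → ℤ) (b : Fin m → ℤ) (R : ℝ) : ℝ :=
  ∑ dd ∈ Fintype.piFinset (fun _ : Fin m ⊕ Fin m => squarefreeOf P),
    (∏ v, (μ (dd v) : ℝ)) * tupleDensity W L b (fun j => dd (Sum.inl j)) (fun j => dd (Sum.inr j)) *
      ∏ v, lamR R (dd v)

/-- The term of the expansion indexed by `S ⊆ P`:
`Σ_S = ∑_{dd} (∏_{p∈S} Δ_p(Y_p)) (∏_{p ∈ P∖S} T^mod_p(Y_p)) ∏_v λ_R(dd_v)`.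
[cite: GreenTaoAnnals2008, Section 10 eq. 10.8] -/
def sTerm (P S : Finset ℕ) (W : ℕ) (L : Fin m → Fin t → ℤ) (b : Fin m → ℤ) (R : ℝ) : ℝ :=
  ∑ dd ∈ Fintype.piFinset (fun _ : Fin m ⊕ Fin m => squarefreeOf P),
    ((∏ p ∈ S, locD p W L b (pattern dd p)) * ∏ p ∈ P \ S, locM p W (pattern dd p)) * ∏ v, lamR R (dd v)

/-- **The expansion** `S(P) = ∑_{S ⊆ P} Σ_S` (`T_p = Δ_p + T^mod_p`, `∏ (f+g) = ∑_S ∏_S f ∏_{Sᶜ} g`).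
[cite: GreenTaoAnnals2008, Section 10 eq. 10.8] -/
theorem sharpTupleSum_eq_sum_sTerm {P : Finset ℕ} (hP : ∀ p ∈ P, p.Prime) (W : ℕ)
    (L : Fin m → Fin t → ℤ) (b : Fin m → ℤ) (R : ℝ) :
    sharpTupleSum P W L b R = ∑ S ∈ P.powerset, sTerm P S W L b R := by
  unfold sharpTupleSum sTerm
  rw [sum_comm]
  refine sum_congr rfl fun dd hdd => ?_
  rw [Fintype.mem_piFinset] at hdd
  rw [prod_moebius_mul_tupleDensity_eq hP W L b hdd, ← sum_mul]
  congr 1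
  rw [prod_congr rfl fun p _ => locT_eq_add p W L b (pattern dd p)]
  exact prod_add _ _ _

/-! ### The `S`-free sum is the diagonal sum -/

/-- For `s = ∏_{p ∈ S} p` (`S` a set of primes) and square-free `a ≠ 0`:
`Disjoint (primeFactors a) S ↔ (a, s) = 1`. [folklore] -/
theorem disjoint_iff_coprime_prod {S : Finset ℕ} (hS : ∀ p ∈ S, p.Prime) {a : ℕ} (ha : a ≠ 0) :
    Disjoint a.primeFactors S ↔ a.Coprime (∏ p ∈ S, p) := by
  have hs0 : ∏ p ∈ S, p ≠ 0 := prod_ne_zero_iff.2 fun p hp => (hS p hp).ne_zero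
  rw [← Nat.disjoint_primeFactors ha hs0, Nat.primeFactors_prod hS]

/-- The slot sums of the `S`-free part: for `P' = P ∖ S`, `y = R/u ≤ R` etc.,
`{a ∈ squarefreeOf P' : a ≤ y, (a,W)=1} = {a ≤ y : a squarefree, (a, sW) = 1}`
provided every prime `≤ R` lies in `P`. [folklore] -/
theorem filter_squarefreeOf_sdiff_eq {P S : Finset ℕ} (hP : ∀ p ∈ P, p.Prime) (hS : S ⊆ P) {R : ℝ}
    (hPR : ∀ p : ℕ, p.Prime → (p : ℝ) ≤ R → p ∈ P) (W : ℕ) {y : ℝ} (hy : y ≤ R) :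
    (squarefreeOf (P \ S)).filter (fun a : ℕ => (a : ℝ) ≤ y ∧ a.Coprime W) =
      (Icc 1 ⌊y⌋₊).filter (fun a => Squarefree a ∧ a.Coprime ((∏ p ∈ S, p) * W)) := by
  have hSp : ∀ p ∈ S, p.Prime := fun p hp => hP p (hS hp)
  have hPp : ∀ p ∈ P \ S, p.Prime := fun p hp => hP p (mem_sdiff.1 hp).1
  ext a
  rw [mem_filter, mem_filter, mem_Icc, mem_squarefreeOf hPp, Nat.coprime_mul_iff_right]
  constructor
  · rintro ⟨⟨hsq, hsub⟩, hay, haW⟩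
    have ha1 : 1 ≤ a := Nat.pos_of_ne_zero hsq.ne_zero
    refine ⟨⟨ha1, Nat.le_floor hay⟩, hsq, ?_, haW⟩
    rw [← disjoint_iff_coprime_prod hSp hsq.ne_zero]
    exact disjoint_left.2 fun p hp hpS => (mem_sdiff.1 (hsub hp)).2 hpS
  · rintro ⟨⟨ha1, hay⟩, hsq, has, haW⟩
    have hy0 : (a : ℝ) ≤ y := by
      have h0 : 0 < ⌊y⌋₊ := by omega
      exact (Nat.cast_le.2 hay).trans (Nat.floor_le (Nat.pos_of_floor_pos h0).le)
    refine ⟨⟨hsq, fun p hp => ?_⟩, hy0, haW⟩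
    have hpp := Nat.prime_of_mem_primeFactors hp
    have hpa : (p : ℝ) ≤ a := by exact_mod_cast Nat.le_of_dvd (by omega) (Nat.dvd_of_mem_primeFactors hp)
    refine mem_sdiff.2 ⟨hPR p hpp (hpa.trans (hy0.trans hy)), fun hpS => ?_⟩
    have hdis := (disjoint_iff_coprime_prod hSp hsq.ne_zero).2 has
    exact disjoint_left.1 hdis hp hpS

/-- `diagSum` may be restricted to square-free variables (the others have `μ = 0`). [folklore] -/
theorem diagSum_eq_sum_squarefree (q : ℕ) (y y' : ℝ) :
    diagSum q y y' = ∑ a ∈ (Icc 1 ⌊y⌋₊).filter (fun a => Squarefree a ∧ a.Coprime q),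
      ∑ b ∈ (Icc 1 ⌊y'⌋₊).filter (fun b => Squarefree b ∧ b.Coprime q),
        (μ a : ℝ) / a * Real.log (y / a) * ((μ b : ℝ) / b * Real.log (y' / b)) * (Nat.gcd a b : ℝ) := by
  unfold diagSum
  have hsub : ∀ z : ℝ, (Icc 1 ⌊z⌋₊).filter (fun a => Squarefree a ∧ a.Coprime q) ⊆
      (Icc 1 ⌊z⌋₊).filter (fun a => a.Coprime q) := fun z a ha => by
    rw [mem_filter] at ha ⊢; exact ⟨ha.1, ha.2.2⟩
  have hvan : ∀ (z : ℝ) (a : ℕ), a ∈ (Icc 1 ⌊z⌋₊).filter (fun a => a.Coprime q) →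
      a ∉ (Icc 1 ⌊z⌋₊).filter (fun a => Squarefree a ∧ a.Coprime q) → (μ a : ℝ) = 0 := by
    intro z a ha ha'
    rw [mem_filter] at ha ha'
    have hsq : ¬ Squarefree a := fun h => ha' ⟨ha.1, h, ha.2⟩
    exact_mod_cast ArithmeticFunction.moebius_eq_zero_of_not_squarefree hsq
  symm
  rw [sum_subset (hsub y) (fun a ha ha' => by
    rw [hvan y a ha ha']; simp only [zero_div, zero_mul]; exact sum_const_zero)]
  refine sum_congr rfl fun a _ => ?_
  exact sum_subset (hsub y') fun b hb hb' => by rw [hvan y' b hb hb']; simp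

/-- **The `S`-free slot sum is the diagonal sum**: with `P' = P ∖ S`, `s = ∏ S`, `1 ≤ u, u'`, `R ≥ 0`,
`∑_{a, b ∈ squarefreeOf P'} τ_W(a,b) λ_R(u a) λ_R(u' b) = S₁(sW; R/u, R/u')`, provided every prime
`≤ R` lies in `P`. [cite: GreenTaoAnnals2008, Section 10 eq. 10.2] -/
theorem sum_tauW_lamR_eq_diagSum {P S : Finset ℕ} (hP : ∀ p ∈ P, p.Prime) (hS : S ⊆ P) {R : ℝ} (hR : 0 ≤ R)
    (hPR : ∀ p : ℕ, p.Prime → (p : ℝ) ≤ R → p ∈ P) (W : ℕ) {u u' : ℕ} (hu : 1 ≤ u) (hu' : 1 ≤ u') :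
    ∑ a ∈ squarefreeOf (P \ S), ∑ b ∈ squarefreeOf (P \ S), tauW W a b * lamR R (u * a) * lamR R (u' * b) =
      diagSum ((∏ p ∈ S, p) * W) (R / u) (R / u') := by
  have hPp : ∀ p ∈ P \ S, p.Prime := fun p hp => hP p (mem_sdiff.1 hp).1
  set y : ℝ := R / u with hy
  set y' : ℝ := R / u' with hy'
  have hu0 : (0 : ℝ) < u := by exact_mod_cast hu
  have hu0' : (0 : ℝ) < u' := by exact_mod_cast hu'
  have hyR : y ≤ R := div_le_self hR (by exact_mod_cast hu)
  have hyR' : y' ≤ R := div_le_self hR (by exact_mod_cast hu')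
  have hy0 : 0 ≤ y := div_nonneg hR hu0.le
  have hy0' : 0 ≤ y' := div_nonneg hR hu0'.le
  -- rewrite the weights and restrict to the non-vanishing part
  have hmem1 : ∀ a ∈ squarefreeOf (P \ S), 1 ≤ a := fun a ha => Nat.pos_of_ne_zero ((mem_squarefreeOf hPp).1 ha).1.ne_zero
  rw [diagSum_eq_sum_squarefree, ← filter_squarefreeOf_sdiff_eq hP hS hPR W hyR,
    ← filter_squarefreeOf_sdiff_eq hP hS hPR W hyR']
  rw [sum_filter]
  refine sum_congr rfl fun a ha => ?_
  have ha1 := hmem1 a ha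
  by_cases hca : (a : ℝ) ≤ y ∧ a.Coprime W
  · rw [if_pos hca, sum_filter]
    refine sum_congr rfl fun b hb => ?_
    have hb1 := hmem1 b hb
    by_cases hcb : (b : ℝ) ≤ y' ∧ b.Coprime W
    · rw [if_pos hcb]
      unfold tauW
      rw [if_pos ⟨hca.2, hcb.2⟩, lamR_mul hu, lamR_mul hu', lamR_eq_log ha1 hca.1, lamR_eq_log hb1 hcb.1]
      ring
    · rw [if_neg hcb]
      rcases not_and_or.1 hcb with h | h
      · rw [lamR_mul hu', lamR_eq_zero hy0' hb1 (not_le.1 h).le]; ring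
      · unfold tauW; rw [if_neg (fun h' => h h'.2)]; ring
  · rw [if_neg hca]
    refine sum_eq_zero fun b _ => ?_
    rcases not_and_or.1 hca with h | h
    · rw [lamR_mul hu, lamR_eq_zero hy0 ha1 (not_le.1 h).le]; ring
    · unfold tauW; rw [if_neg (fun h' => h h'.1)]; ring


/-! ### The terms of the expansion -/

/-- `∏_v λ_R(dd_v) = ∏_j λ_R(dd_{inl j}) λ_R(dd_{inr j})`. [folklore] -/
theorem prod_lamR_sum_type (R : ℝ) (dd : Fin m ⊕ Fin m → ℕ) :
    ∏ v, lamR R (dd v) = ∏ j : Fin m, (lamR R (dd (Sum.inl j)) * lamR R (dd (Sum.inr j))) := by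
  rw [Fintype.prod_sum_type, prod_mul_distrib]

/-- Entries of tuples of square-free numbers are `≥ 1`. [folklore] -/
theorem one_le_of_mem_squarefreeOf {P : Finset ℕ} (hP : ∀ p ∈ P, p.Prime) {d : ℕ} (hd : d ∈ squarefreeOf P) :
    1 ≤ d := Nat.pos_of_ne_zero ((mem_squarefreeOf hP).1 hd).1.ne_zero

section Estimate

variable {n : ℕ} {P : Finset ℕ} (hP : ∀ p ∈ P, p.Prime) {W : ℕ} (hW : W ≠ 0)
  (hPW : ∀ p : ℕ, p.Prime → p ∣ W → p ∈ P) {R : ℝ} (hR : 1 ≤ R)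
  (hPR : ∀ p : ℕ, p.Prime → (p : ℝ) ≤ R → p ∈ P)
include hP

/-- **The term `S = ∅` is `S₁(W; R, R)^m`.** [cite: GreenTaoAnnals2008, Section 10 eq. 10.9] -/
theorem sTerm_empty (L : Fin m → Fin t → ℤ) (b : Fin m → ℤ) (hPW : ∀ p : ℕ, p.Prime → p ∣ W → p ∈ P)
    (hR : 1 ≤ R) (hPR : ∀ p : ℕ, p.Prime → (p : ℝ) ≤ R → p ∈ P) :
    sTerm P ∅ W L b R = diagSum W R R ^ m := by
  classical
  unfold sTerm
  have hkey := sum_tauW_lamR_eq_diagSum hP (empty_subset P) (by linarith) hPR W le_rfl le_rfl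
  simp only [prod_empty, one_mul, Nat.cast_one, div_one, sdiff_empty] at hkey ⊢
  calc ∑ dd ∈ Fintype.piFinset (fun _ : Fin m ⊕ Fin m => squarefreeOf P),
        (∏ p ∈ P, locM p W (pattern dd p)) * ∏ v, lamR R (dd v)
      = ∑ dd ∈ Fintype.piFinset (fun _ : Fin m ⊕ Fin m => squarefreeOf P),
          ∏ j : Fin m, (tauW W (dd (Sum.inl j)) (dd (Sum.inr j)) * lamR R (dd (Sum.inl j)) *
            lamR R (dd (Sum.inr j))) := by
        refine sum_congr rfl fun dd hdd => ?_
        rw [Fintype.mem_piFinset] at hdd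
        rw [prod_locM_eq_prod_tauW hP hPW hdd, prod_lamR_sum_type, ← prod_mul_distrib]
        refine prod_congr rfl fun j _ => ?_
        ring
    _ = ∏ _j : Fin m, diagSum W R R := by
        rw [sum_piFinset_sum_prod_eq (squarefreeOf P) (fun _ a b' => tauW W a b' * lamR R a * lamR R b')]
        exact prod_congr rfl fun j _ => hkey
    _ = diagSum W R R ^ m := by rw [prod_const, card_univ, Fintype.card_fin]

/-- A term indexed by a set containing a prime dividing `W` vanishes (`Δ_p = 0` there).
[cite: GreenTaoAnnals2008, Lemma 10.1] -/
theorem sTerm_eq_zero_of_dvd {S : Finset ℕ} (hS : S ⊆ P) {p : ℕ} (hpS : p ∈ S) (hpW : p ∣ W)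
    (L : Fin m → Fin t → ℤ) (b : Fin m → ℤ) : sTerm P S W L b R = 0 := by
  haveI : Fact p.Prime := ⟨hP p (hS hpS)⟩
  unfold sTerm
  refine sum_eq_zero fun dd _ => ?_
  rw [prod_eq_zero hpS (locD_of_dvd hpW L b _)]
  ring

/-- **The term indexed by a set `S` of primes off `W` factorises**:
`Σ_S = ∑_{u ∈ (squarefreeOf S)^{[m]⊔[m]}} Δ_S(u) ∏_j S₁(sW; R/u_{inl j}, R/u_{inr j})`, `s = ∏ S`.
[cite: GreenTaoAnnals2008, Section 10 eq. 10.8] -/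
theorem sTerm_eq_sum_prod_diagSum {S : Finset ℕ} (hS : S ⊆ P) (hSW : ∀ p ∈ S, ¬ p ∣ W)
    (L : Fin m → Fin t → ℤ) (b : Fin m → ℤ) (hPW : ∀ p : ℕ, p.Prime → p ∣ W → p ∈ P) (hR : 1 ≤ R)
    (hPR : ∀ p : ℕ, p.Prime → (p : ℝ) ≤ R → p ∈ P) :
    sTerm P S W L b R = ∑ u ∈ Fintype.piFinset (fun _ : Fin m ⊕ Fin m => squarefreeOf S),
      (∏ p ∈ S, locD p W L b (pattern u p)) *
        ∏ j : Fin m, diagSum ((∏ p ∈ S, p) * W) (R / u (Sum.inl j)) (R / u (Sum.inr j)) := by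
  classical
  have hSp : ∀ p ∈ S, p.Prime := fun p hp => hP p (hS hp)
  have hPp : ∀ p ∈ P \ S, p.Prime := fun p hp => hP p (mem_sdiff.1 hp).1
  have hPW' : ∀ p : ℕ, p.Prime → p ∣ W → p ∈ P \ S := fun p hp hpW =>
    mem_sdiff.2 ⟨hPW p hp hpW, fun hpS => hSW p hpS hpW⟩
  unfold sTerm
  rw [sum_tuples_split hP hS]
  refine sum_congr rfl fun u hu => ?_
  rw [Fintype.mem_piFinset] at hu
  have hu1 : ∀ v, 1 ≤ u v := fun v => one_le_of_mem_squarefreeOf hSp (hu v)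
  -- evaluate the summand on `u * c`
  have hsummand : ∀ c ∈ Fintype.piFinset (fun _ : Fin m ⊕ Fin m => squarefreeOf (P \ S)),
      ((∏ p ∈ S, locD p W L b (pattern (u * c) p)) * ∏ p ∈ P \ S, locM p W (pattern (u * c) p)) *
          ∏ v, lamR R ((u * c) v) =
        (∏ p ∈ S, locD p W L b (pattern u p)) *
          ∏ j : Fin m, (tauW W (c (Sum.inl j)) (c (Sum.inr j)) * lamR R (u (Sum.inl j) * c (Sum.inl j)) *
            lamR R (u (Sum.inr j) * c (Sum.inr j))) := by
    intro c hc
    rw [Fintype.mem_piFinset] at hc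
    have hpat := fun p => pattern_mul_of_mem (ι := Fin m ⊕ Fin m) hP hS hu hc (p := p)
    have e1 : ∏ p ∈ S, locD p W L b (pattern (u * c) p) = ∏ p ∈ S, locD p W L b (pattern u p) :=
      prod_congr rfl fun p hp => by rw [(hpat p).1 hp]
    have e2 : ∏ p ∈ P \ S, locM p W (pattern (u * c) p) = ∏ p ∈ P \ S, locM p W (pattern c p) :=
      prod_congr rfl fun p hp => by rw [(hpat p).2 hp]
    rw [e1, e2, prod_locM_eq_prod_tauW hPp hPW' hc, prod_lamR_sum_type, mul_assoc, ← prod_mul_distrib]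
    congr 1
    refine prod_congr rfl fun j _ => ?_
    simp only [Pi.mul_apply]
    ring
  rw [sum_congr rfl hsummand, ← mul_sum]
  congr 1
  rw [sum_piFinset_sum_prod_eq (squarefreeOf (P \ S))
    (fun j a b' => tauW W a b' * lamR R (u (Sum.inl j) * a) * lamR R (u (Sum.inr j) * b'))]
  exact prod_congr rfl fun j _ => sum_tauW_lamR_eq_diagSum hP hS (by linarith) hPR W (hu1 _) (hu1 _)

omit hP in
/-- `s/φ(s) ≤ 2^{|S|}` for `s = ∏_{p ∈ S} p`, hence `(s/φ(s))² ≤ ∏_{p ∈ S} 4`. [folklore] -/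
theorem div_totient_prod_sq_le {S : Finset ℕ} (hS : ∀ p ∈ S, p.Prime) :
    (((∏ p ∈ S, p : ℕ) : ℝ) / ((∏ p ∈ S, p).totient : ℝ)) ^ 2 ≤ ∏ _p ∈ S, (4 : ℝ) := by
  have hs0 : ∏ p ∈ S, p ≠ 0 := prod_ne_zero_iff.2 fun p hp => (hS p hp).ne_zero
  rw [div_totient_eq_rankinProd hs0]
  unfold rankinProd
  rw [Nat.primeFactors_prod hS, ← prod_pow]
  refine prod_le_prod (fun p hp => by
    have := one_le_rankinFactor (hS p hp) one_pos; positivity) fun p hp => ?_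
  have hp2 : (2 : ℝ) ≤ p := by exact_mod_cast (hS p hp).two_le
  have hfac : (1 - (p : ℝ) ^ (-(1 : ℝ)))⁻¹ ≤ 2 := by
    rw [Real.rpow_neg (by positivity), Real.rpow_one]
    have hp0 : (0 : ℝ) < p := by linarith
    rw [inv_le_comm₀ (by rw [sub_pos]; exact inv_lt_one_of_one_lt₀ (by linarith)) two_pos]
    have : (p : ℝ)⁻¹ ≤ 1 / 2 := by rw [inv_eq_one_div]; exact one_div_le_one_div_of_le two_pos hp2
    linarith
  have h0 : 0 ≤ (1 - (p : ℝ) ^ (-(1 : ℝ)))⁻¹ := zero_le_one.trans (one_le_rankinFactor (hS p hp) one_pos)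
  nlinarith

include hW

/-- **Bound for a term indexed by a nonempty set of primes off `W`** (all `> w ≥ 2C²`, where the
system is non-degenerate and `∑_Y |Δ_p| ≤ 2·4^m/p²`):
`|Σ_S| ≤ (∏_{p∈S} 2·16^m/p²) (B² (W/φ(W))² G_W(R))^m`. [cite: GreenTaoAnnals2008, Lemma 10.3] -/
theorem abs_sTerm_le {S : Finset ℕ} (hS : S ⊆ P) (hSW : ∀ p ∈ S, ¬ p ∣ W) {C : ℕ}
    (hSC : ∀ p ∈ S, 2 * C ^ 2 < p)
    (L : Fin m → Fin (n + 1) → ℤ) (hC : ∀ i j, |L i j| ≤ C) (hL0 : ∀ i, L i ≠ 0)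
    (hLp : ∀ i i', i ≠ i' → ∀ c : ℚ, (fun j => (L i j : ℚ)) ≠ c • fun j => (L i' j : ℚ))
    (b : Fin m → ℤ) (hPW : ∀ p : ℕ, p.Prime → p ∣ W → p ∈ P) (hR : 1 ≤ R)
    (hPR : ∀ p : ℕ, p.Prime → (p : ℝ) ≤ R → p ∈ P) {B : ℝ} (hB : ∀ y, |moebLog y| ≤ B) :
    |sTerm P S W L b R| ≤ (∏ p ∈ S, 2 * 16 ^ m / (p : ℝ) ^ 2) *
      (B ^ 2 * ((W : ℝ) / (W.totient : ℝ)) ^ 2 * invTotSum W R) ^ m := by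
  classical
  have hSp : ∀ p ∈ S, p.Prime := fun p hp => hP p (hS hp)
  set s : ℕ := ∏ p ∈ S, p with hs
  have hs0 : s ≠ 0 := prod_ne_zero_iff.2 fun p hp => (hSp p hp).ne_zero
  have hsW : s.Coprime W := Nat.Coprime.prod_left fun p hp =>
    (Nat.Prime.coprime_iff_not_dvd (hSp p hp)).2 (hSW p hp)
  have hsW0 : s * W ≠ 0 := mul_ne_zero hs0 hW
  set K₀ : ℝ := B ^ 2 * ((W : ℝ) / (W.totient : ℝ)) ^ 2 * invTotSum W R with hK₀
  have hK0 : 0 ≤ K₀ := by have := invTotSum_nonneg W R; positivity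
  rw [sTerm_eq_sum_prod_diagSum hP hS hSW L b hPW hR hPR]
  -- uniform bound for the product of diagonal sums
  have hD : ∀ u ∈ Fintype.piFinset (fun _ : Fin m ⊕ Fin m => squarefreeOf S),
      |∏ j : Fin m, diagSum (s * W) (R / u (Sum.inl j)) (R / u (Sum.inr j))| ≤ (∏ _p ∈ S, (4 : ℝ) ^ m) * K₀ ^ m := by
    intro u hu
    rw [Fintype.mem_piFinset] at hu
    have hu1 : ∀ v, (1 : ℝ) ≤ u v := fun v => by exact_mod_cast one_le_of_mem_squarefreeOf hSp (hu v)
    rw [abs_prod]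
    have hq : ((s * W : ℕ) : ℝ) / ((s * W).totient : ℝ) = (s : ℝ) / (s.totient : ℝ) * ((W : ℝ) / (W.totient : ℝ)) :=
      div_totient_mul hsW
    have hterm : ∀ j : Fin m, |diagSum (s * W) (R / u (Sum.inl j)) (R / u (Sum.inr j))| ≤
        ((s : ℝ) / (s.totient : ℝ)) ^ 2 * K₀ := by
      intro j
      have h := abs_diagSum_le hB hsW0 (dvd_mul_left W s) (R / u (Sum.inl j)) (R / u (Sum.inr j))
      rw [hq] at h
      refine h.trans ?_
      have hmono : invTotSum W (R / u (Sum.inl j)) ≤ invTotSum W R :=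
        invTotSum_mono W (div_le_self (by linarith) (hu1 _))
      have hB0 : 0 ≤ B ^ 2 * ((s : ℝ) / (s.totient : ℝ) * ((W : ℝ) / (W.totient : ℝ))) ^ 2 := by positivity
      calc B ^ 2 * ((s : ℝ) / (s.totient : ℝ) * ((W : ℝ) / (W.totient : ℝ))) ^ 2 * invTotSum W (R / u (Sum.inl j))
          ≤ B ^ 2 * ((s : ℝ) / (s.totient : ℝ) * ((W : ℝ) / (W.totient : ℝ))) ^ 2 * invTotSum W R :=
            mul_le_mul_of_nonneg_left hmono hB0
        _ = ((s : ℝ) / (s.totient : ℝ)) ^ 2 * K₀ := by rw [hK₀]; ring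
    calc ∏ j : Fin m, |diagSum (s * W) (R / u (Sum.inl j)) (R / u (Sum.inr j))|
        ≤ ∏ _j : Fin m, ((s : ℝ) / (s.totient : ℝ)) ^ 2 * K₀ := prod_le_prod (fun j _ => abs_nonneg _) fun j _ => hterm j
      _ = (((s : ℝ) / (s.totient : ℝ)) ^ 2) ^ m * K₀ ^ m := by rw [prod_const, card_univ, Fintype.card_fin, mul_pow]
      _ ≤ (∏ _p ∈ S, (4 : ℝ)) ^ m * K₀ ^ m := by
          have h1 : (((s : ℝ) / (s.totient : ℝ)) ^ 2) ≤ ∏ _p ∈ S, (4 : ℝ) := div_totient_prod_sq_le hSp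
          exact mul_le_mul_of_nonneg_right (pow_le_pow_left₀ (by positivity) h1 m) (pow_nonneg hK0 m)
      _ = (∏ _p ∈ S, (4 : ℝ) ^ m) * K₀ ^ m := by rw [prod_pow]
  -- the sum of `|Δ_S(u)|` is an Euler product
  have hΔ : ∑ u ∈ Fintype.piFinset (fun _ : Fin m ⊕ Fin m => squarefreeOf S), |∏ p ∈ S, locD p W L b (pattern u p)| ≤
      ∏ p ∈ S, 2 * 4 ^ m / (p : ℝ) ^ 2 := by
    have heq : ∑ u ∈ Fintype.piFinset (fun _ : Fin m ⊕ Fin m => squarefreeOf S), |∏ p ∈ S, locD p W L b (pattern u p)| =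
        ∏ p ∈ S, ∑ Y : Finset (Fin m ⊕ Fin m), |locD p W L b Y| := by
      rw [← prod_coe_sort S, ← sum_squarefreeTuples_eq_prod hSp (fun p Y => |locD (p : ℕ) W L b Y|)]
      refine sum_congr rfl fun u _ => ?_
      rw [abs_prod, ← prod_coe_sort S]
    rw [heq]
    refine prod_le_prod (fun p _ => sum_nonneg fun Y _ => abs_nonneg _) fun p hp => ?_
    haveI : Fact p.Prime := ⟨hSp p hp⟩
    obtain ⟨hrow, hmin⟩ := nondegenerate_mod_of_bounds (hSC p hp) L hC hL0 hLp
    exact sum_abs_locD_le (hSW p hp) L b hrow hmin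
  -- combine
  calc |∑ u ∈ Fintype.piFinset (fun _ : Fin m ⊕ Fin m => squarefreeOf S),
          (∏ p ∈ S, locD p W L b (pattern u p)) * ∏ j : Fin m, diagSum (s * W) (R / u (Sum.inl j)) (R / u (Sum.inr j))|
      ≤ ∑ u ∈ Fintype.piFinset (fun _ : Fin m ⊕ Fin m => squarefreeOf S),
          |∏ p ∈ S, locD p W L b (pattern u p)| * ((∏ _p ∈ S, (4 : ℝ) ^ m) * K₀ ^ m) := by
        refine (abs_sum_le_sum_abs _ _).trans (sum_le_sum fun u hu => ?_)
        rw [abs_mul]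
        exact mul_le_mul_of_nonneg_left (hD u hu) (abs_nonneg _)
    _ ≤ (∏ p ∈ S, 2 * 4 ^ m / (p : ℝ) ^ 2) * ((∏ _p ∈ S, (4 : ℝ) ^ m) * K₀ ^ m) := by
        rw [← sum_mul]
        exact mul_le_mul_of_nonneg_right hΔ (by positivity)
    _ = (∏ p ∈ S, 2 * 16 ^ m / (p : ℝ) ^ 2) * K₀ ^ m := by
        rw [← mul_assoc, ← prod_mul_distrib]
        congr 1
        refine prod_congr rfl fun p _ => ?_
        rw [show (16 : ℝ) = 4 * 4 by norm_num, mul_pow]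
        ring

/-- `∑_{p ∈ P, p ∤ W} 1/p² ≤ 1/w` when every prime off `W` exceeds `w ≥ 1`. [folklore] -/
theorem sum_inv_sq_filter_le {w : ℕ} (hw : 1 ≤ w) (hWw : ∀ p : ℕ, p.Prime → ¬ p ∣ W → w < p) :
    ∑ p ∈ P.filter (fun p => ¬ p ∣ W), 1 / (p : ℝ) ^ 2 ≤ 1 / (w : ℝ) := by
  have _hW := hW
  set N := P.sup id with hN
  have hsub : P.filter (fun p => ¬ p ∣ W) ⊆ Ioc w (max w N) := by
    intro p hp
    obtain ⟨hpP, hpW⟩ := mem_filter.1 hp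
    exact mem_Ioc.2 ⟨hWw p (hP p hpP) hpW, (le_sup hpP (f := id)).trans (le_max_right _ _)⟩
  calc ∑ p ∈ P.filter (fun p => ¬ p ∣ W), 1 / (p : ℝ) ^ 2 ≤ ∑ p ∈ Ioc w (max w N), 1 / (p : ℝ) ^ 2 :=
        sum_le_sum_of_subset_of_nonneg hsub fun p _ _ => by positivity
    _ = ∑ p ∈ Ioc w (max w N), ((p : ℝ) ^ 2)⁻¹ := sum_congr rfl fun p _ => one_div _
    _ ≤ (w : ℝ)⁻¹ - ((max w N : ℕ) : ℝ)⁻¹ := sum_Ioc_inv_sq_le_sub (by omega) (le_max_left _ _)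
    _ ≤ 1 / (w : ℝ) := by rw [one_div]; linarith [inv_nonneg.2 (Nat.cast_nonneg (α := ℝ) (max w N))]

/-- **The sharp tuple sum is the `m`-th power of the diagonal sum up to coupled primes**:
`|S(P) - S₁(W;R,R)^m| ≤ (exp(2·16^m/w) - 1) (B² (W/φ(W))² G_W(R))^m`, for a finite set of primes
`P` containing every prime `≤ R` and every prime factor of `W`, when every prime off `W` exceeds
`w ≥ max(1, 2C²)` and the system has coefficients `≤ C`, nonzero pairwise non-proportional rows
(the sum over `S ≠ ∅` of `abs_sTerm_le`, `∏_{p>w}(1 + 2·16^m/p²) - 1 ≤ exp(2·16^m/w) - 1`).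
[cite: GreenTaoAnnals2008, Lemma 10.3] -/
theorem abs_sharpTupleSum_sub_pow_le {w C : ℕ} (hw : 1 ≤ w) (hwC : 2 * C ^ 2 ≤ w)
    (hWw : ∀ p : ℕ, p.Prime → ¬ p ∣ W → w < p)
    (L : Fin m → Fin (n + 1) → ℤ) (hC : ∀ i j, |L i j| ≤ C) (hL0 : ∀ i, L i ≠ 0)
    (hLp : ∀ i i', i ≠ i' → ∀ c : ℚ, (fun j => (L i j : ℚ)) ≠ c • fun j => (L i' j : ℚ))
    (b : Fin m → ℤ) (hPW : ∀ p : ℕ, p.Prime → p ∣ W → p ∈ P) (hR : 1 ≤ R)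
    (hPR : ∀ p : ℕ, p.Prime → (p : ℝ) ≤ R → p ∈ P) {B : ℝ} (hB : ∀ y, |moebLog y| ≤ B) :
    |sharpTupleSum P W L b R - diagSum W R R ^ m| ≤
      (Real.exp (2 * 16 ^ m / (w : ℝ)) - 1) * (B ^ 2 * ((W : ℝ) / (W.totient : ℝ)) ^ 2 * invTotSum W R) ^ m := by
  classical
  set K₀ : ℝ := B ^ 2 * ((W : ℝ) / (W.totient : ℝ)) ^ 2 * invTotSum W R with hK₀
  have hK0 : 0 ≤ K₀ := by have := invTotSum_nonneg W R; positivity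
  -- the weight of a set of primes
  set c : ℕ → ℝ := fun p => if p ∣ W then 0 else 2 * 16 ^ m / (p : ℝ) ^ 2 with hc
  have hc0 : ∀ p, 0 ≤ c p := fun p => by simp only [hc]; split_ifs <;> positivity
  -- every term with `S ≠ ∅` is bounded by `(∏_S c) K₀^m`
  have hterm : ∀ S ∈ P.powerset, S ≠ ∅ → |sTerm P S W L b R| ≤ (∏ p ∈ S, c p) * K₀ ^ m := by
    intro S hS hSne
    have hS' : S ⊆ P := mem_powerset.1 hS
    by_cases hgood : ∀ p ∈ S, ¬ p ∣ W
    · have hprod : ∏ p ∈ S, c p = ∏ p ∈ S, 2 * 16 ^ m / (p : ℝ) ^ 2 :=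
        prod_congr rfl fun p hp => by simp only [hc]; rw [if_neg (hgood p hp)]
      rw [hprod]
      refine abs_sTerm_le hP hW hS' hgood (C := C) (fun p hp => ?_) L hC hL0 hLp b hPW hR hPR hB
      have := hWw p (hP p (hS' hp)) (hgood p hp)
      omega
    · push Not at hgood
      obtain ⟨p, hpS, hpW⟩ := hgood
      rw [sTerm_eq_zero_of_dvd hP hS' hpS hpW L b, abs_zero]
      exact mul_nonneg (prod_nonneg fun q _ => hc0 q) (pow_nonneg hK0 m)
  -- sum over `S`
  rw [sharpTupleSum_eq_sum_sTerm hP W L b R, ← Finset.add_sum_erase _ _ (empty_mem_powerset P),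
    sTerm_empty hP L b hPW hR hPR, add_sub_cancel_left]
  have hsum : |∑ S ∈ (P.powerset).erase ∅, sTerm P S W L b R| ≤ (∑ S ∈ (P.powerset).erase ∅, ∏ p ∈ S, c p) * K₀ ^ m := by
    refine (abs_sum_le_sum_abs _ _).trans ?_
    rw [sum_mul]
    exact sum_le_sum fun S hS => hterm S (mem_of_mem_erase hS) (ne_of_mem_erase hS)
  refine hsum.trans (mul_le_mul_of_nonneg_right ?_ (pow_nonneg hK0 m))
  -- `∑_{S ≠ ∅} ∏_S c = ∏_P (1 + c) - 1 ≤ exp(∑ c) - 1 ≤ exp(2·16^m/w) - 1`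
  have hexp : ∑ S ∈ (P.powerset).erase ∅, ∏ p ∈ S, c p = ∏ p ∈ P, (1 + c p) - 1 := by
    rw [prod_one_add, ← Finset.add_sum_erase _ _ (empty_mem_powerset P), prod_empty]
    ring
  rw [hexp]
  have h1 : ∏ p ∈ P, (1 + c p) ≤ Real.exp (∑ p ∈ P, c p) := by
    rw [Real.exp_sum]
    exact prod_le_prod (fun p _ => by linarith [hc0 p]) fun p _ => by linarith [Real.add_one_le_exp (c p)]
  have h2 : ∑ p ∈ P, c p ≤ 2 * 16 ^ m / (w : ℝ) := by
    have hsplit : ∑ p ∈ P, c p = ∑ p ∈ P.filter (fun p => ¬ p ∣ W), 2 * 16 ^ m / (p : ℝ) ^ 2 := by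
      rw [sum_filter]
      refine sum_congr rfl fun p _ => ?_
      by_cases h : p ∣ W
      · simp [hc, h]
      · simp [hc, h]
    rw [hsplit]
    have h3 := sum_inv_sq_filter_le hP hW hw hWw
    calc ∑ p ∈ P.filter (fun p => ¬ p ∣ W), 2 * 16 ^ m / (p : ℝ) ^ 2
        = 2 * 16 ^ m * ∑ p ∈ P.filter (fun p => ¬ p ∣ W), 1 / (p : ℝ) ^ 2 := by
          rw [mul_sum]; exact sum_congr rfl fun p _ => by ring
      _ ≤ 2 * 16 ^ m * (1 / (w : ℝ)) := mul_le_mul_of_nonneg_left h3 (by positivity)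
      _ = 2 * 16 ^ m / (w : ℝ) := by ring
  linarith [Real.exp_le_exp.2 h2]

end Estimate

end Literature.NumberTheory.Sieve.GreenTao2008.SharpGY
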